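import Literature.NumberTheory.Automorphic.AutomorphicRepsGLIrreducibleL2HC
import Literature.NumberTheory.Automorphic.AutomorphicRepsGLCuspidalL2Step3b
import HarnessLib

/-!
# Realisation of irreducible spaces of cusp forms on `GL_n` in `L²_cusp`, third layer: the
# `K`-finite half of Harish-Chandra's correspondence PROVED from admissibility

Topic `NumberTheory/Automorphic`; sequel to `AutomorphicRepsGLIrreducibleL2HC`, which reduced the
named fact `AutomorphicRepsGL.cuspidal_closure_irreducible hcpt μ` of
`AutomorphicRepsGLIrreducibleL2Proofs` (Harish-Chandra 1953, Thm. 5, for an irreducible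
`(𝔤, K_∞) × GL_n(𝔸_K^∞)`-stable space `W` of `A_G`-invariant cusp forms on `GL_n(𝔸_K)`: a closed
`GL_n(𝔸_K)`-invariant subspace `Q` of `L²` inside the closure `Cl[W]` of the classes of `W` is `⊥`
or contains `[W]`) to boundedness (`cuspidal_bounded hcpt`) and ONE named fact,
`AutomorphicRepsGL.cuspidal_closure_exists_mem_l2OfForms hcpt μ` (a non-zero such `Q` contains a
non-zero class of an element of `W`), whose printed proof uses the density of the `K`-finite
vectors of `Q` (Harish-Chandra 1953, Thms. 4 and 6) and `Cl(V') ∩ U' = V'` for the admissible `W`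
(Thm. 5; admissibility by Harish-Chandra's finiteness theorem, Borel–Jacquet 1979, 4.3 (i), 4.5).

This file PROVES that fact from the admissibility of `W` ALONE — for every level `U`, the
`K_∞`-module `(W / ⊥)^U` has finite `K_∞`-multiplicities (`IsAdmissibleGK (π.kRepFixed U)`; this
is the second clause of the named fact `automorphicRep_isAdmissible hcpt` of `LangAutomorphicForms`,
Borel–Jacquet 1979, 4.5, restricted to the cuspidal data `π = W / ⊥` the target concerns, and is
carried here as an explicit hypothesis `hadm`) — dispensing with the density of `K`-finite vectors:

* `AutomorphicRepsGL.cuspidal_closure_exists_mem_l2OfForms_of_isAdmissibleGK` (**proved**). Let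
  `π = W / ⊥` be cuspidal with `(W / ⊥)^U` admissible for every level `U`, and `⊥ ≠ Q ≤ Cl[W]`
  closed invariant. The orthogonal projection `P_Q` commutes with the unitary `R(g)`
  (`IsUnitary.starProjection_map_eq`); some `w = [g] ∈ [W]` has `x = P_Q w ≠ 0` (otherwise
  `[W] ⊆ Qᗮ`, so `Q ⊆ Cl[W] ⊆ Qᗮ`); `x ∈ Q ⊆ Cl[W]` is fixed by the level `U` of `invQuot g` and
  is `K_∞`-finite (its orbit span is `P_Q` of that of `w`). Now the argument of Step 3b
  (`AutomorphicRepsGLCuspidalL2Step3b`, Harish-Chandra's `Cl(V') ∩ U' = V'` by orthogonal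
  projections; here `mem_l2OfForms_of_mem_closure_of_kFinite`): with `F` the orbit span of `x`, `p`
  the orthogonal projection onto the `U`-fixed vectors and `q` the one onto the closure of the
  `F`-part of `L²`, `E = q ∘ p` fixes `x` and maps `[W]` into `[W] ∩ A`, `A` the `F`-part of
  `S = [W] ∩ Fix(U)`; `A` is finite-dimensional because `S` embeds `K_∞`-equivariantly into
  `(W / ⊥)^U` (`exists_injective_intertwiningMap_kRepFixed`: `[g] ↦ invQuot g mod ⊥`, continuous
  representatives being unique) and admissibility passes to the source of an injective `K_∞`-map
  (`isAdmissibleGK_of_injective`); so `[W] ∩ A` is closed and `x = E x ∈ Cl(E [W]) ⊆ [W]`: a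
  non-zero element of `[W] ∩ Q`. This is Harish-Chandra's proof of Thm. 5 (p. 229: "since
  `dim (V'_𝔇) ≤ dim ℌ_𝔇 < ∞`, `V_𝔇 = V'_𝔇`") with the isotypic projectors `E_𝔇` replaced by
  `P_Q`, `p`, `q`.
* `AutomorphicRepsGL.cuspidal_closure_irreducible_of_isAdmissibleGK` (**proved**): hence
  `cuspidal_closure_irreducible hcpt μ` from `cuspidal_bounded hcpt` and `hadm`
  (`cuspidal_closure_irreducible_of` of the sibling file, where boundedness gives the
  Lie-stability of the elements of `W` with class in `Q`).
* `AutomorphicRepsGL.exists_le_formsOfL2_of_W'_eq_bot_of_isAdmissibleGK`,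
  `AutomorphicRepsGL.exists_isAssociatedL2_of_isAdmissibleGK` (**proved**): the realisation fact
  `exists_le_formsOfL2_of_W'_eq_bot hcpt μ` of `AutomorphicRepsGLIrreducibleL2` on the trust base
  `{cuspidal_bounded, cuspidal_analyticAt_rightRegular, hadm}` — boundedness of cusp forms
  (Getz–Hahn Thm. 9.8.1), analyticity of the orbits of `K`-finite `Z(𝔤)`-finite cusp forms
  (Harish-Chandra 1953, Lemma 34) and admissibility of cuspidal automorphic representations
  (Borel–Jacquet 4.5) — and `exists_isAssociatedL2 hcpt μ` on the same plus semisimplicity and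
  `formsOfL2_irreducible`.

Lemmas (proved): `isAdmissibleGK_of_injective` (finite `K`-multiplicities pass to the source of an
injective `K`-map), `AutomorphicRepData.coe_kRepFixed_apply`,
`exists_linearMap_continuous_toLp_eq_of_l2OfForms` (continuous representatives of the classes of a
space of continuous functions depend linearly on the class, are unique and follow translations),
`exists_linearMap_form_of_l2OfForms` (the injective map "class ↦ form" `S → W` for `S ≤ [W]`),
`exists_injective_intertwiningMap_kRepFixed`, `mem_l2OfForms_of_mem_closure_of_kFinite`
(`K_∞`-finite `U`-fixed vectors of `Cl[W]` lie in `[W]` as soon as `[W] ∩ Fix(U)` is admissible).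

## Design notes

* The admissibility hypothesis `hadm` is exactly the second clause of
  `automorphicRep_isAdmissible hcpt` (`LangAutomorphicForms`) restricted to the data `π` with
  `W' = ⊥` the target concerns (`IsAdmissibleGK (π.kRepFixed (U.subgroupOf G(𝔸_f)))`,
  `U ∈ finiteLevelsGL n K`), so that `(automorphicRep_isAdmissible hcpt) π.1 |>.2` supplies it; it
  is kept as a hypothesis (rather than importing that file) so that this layer depends only on the
  sibling proof files. No named fact and no definition is introduced. The `A_G`-invariance
  hypothesis of the target is not used in this direction.
* Not restated: `cuspidal_closure_exists_mem_l2OfForms`, `cuspidal_closure_irreducible` keep their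
  names and meanings; this file only adds proofs over the admissibility hypothesis.
* (H5) `open scoped Classical`; no instance; no `sorry`.

## References

* Harish-Chandra, *Representations of a semisimple Lie group on a Banach space. I*, Trans. AMS 75
  (1953), 185–243 (held, `paper:doi-10-1090-s0002-9947-1953-0056610-2`, PDF p. = printed p. − 184):
  Thm. 5 and its proof (printed pp. 228–229), Lemma 33, Thm. 4, Thm. 6 [HarishChandraTAMS1953].
* A. Borel, H. Jacquet, *Automorphic forms and automorphic representations*, Proc. Sympos. Pure
  Math. 33 (Corvallis 1977), Part 1 (1979), 189–202, §4.3 (i), 4.5, 4.6 [BorelJacquetCorvallis1979].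
* M. Libine, *Introduction to Representations of Real Semisimple Lie Groups*, arXiv:1212.2578,
  Lemma 74, Cor. 75 [Libine2012].
* J. R. Getz, H. Hahn, *An Introduction to Automorphic Representations*, GTM 300 (2024), Def. 4.4,
  §6.3 (p. 117), Thm. 6.5.2, Thm. 9.8.1 [GetzHahn2024].
-/

open scoped MatrixGroups Matrix ContDiff Classical InnerProductSpace
open NumberField NumberField.mixedEmbedding IsDedekindDomain
open _root_.MeasureTheory

noncomputable section

namespace Literature.NumberTheory.Automorphic

/-! ### 1. Finite `K`-multiplicities pass to the source of an injective `K`-map -/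

section Transfer

variable {A : Type*} [NormedCommRing A] [NormedAlgebra ℝ A] [NormedAlgebra ℚ A] [CompleteSpace A]
  [StarRing A] {N : Type*} [Fintype N] [DecidableEq N] {G : RealMatrixGroup A N}
  {V₁ V₂ : Type*} [AddCommGroup V₁] [Module ℂ V₁] [AddCommGroup V₂] [Module ℂ V₂]
  {ρ₁ : Representation ℂ G.maximalCompact V₁} {ρ₂ : Representation ℂ G.maximalCompact V₂}

/-- **Admissibility passes to subrepresentations**: if `T : ρ₁ → ρ₂` is an injective `K`-map and
every irreducible finite-dimensional `τ` has `dim Hom_K(τ, ρ₂) < ∞`, then also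
`dim Hom_K(τ, ρ₁) < ∞` (composition with `T` is an injective linear map
`Hom_K(τ, ρ₁) → Hom_K(τ, ρ₂)`). Wallach, *Real Reductive Groups I*, §3.3.1. [folklore] -/
theorem isAdmissibleGK_of_injective (T : ρ₁.IntertwiningMap ρ₂) (hT : Function.Injective T)
    (h : IsAdmissibleGK ρ₂) : IsAdmissibleGK ρ₁ := by
  intro W _ _ _ τ hτ
  haveI := h W τ hτ
  refine Module.Finite.of_injective (Representation.IntertwiningMap.llcomp τ ρ₁ ρ₂ T)
    fun S₁ S₂ hS ↦ ?_
  refine Representation.IntertwiningMap.ext (LinearMap.ext fun w ↦ hT ?_)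
  exact congrArg (fun S : τ.IntertwiningMap ρ₂ ↦ S w) hS

end Transfer

/-! ### 2. Continuous representatives of classes, and the `K_∞`-map `[W] ∩ Fix(U) → (W / ⊥)^U` -/

section Representatives

variable {n : ℕ} {K : Type} [Field K] [NumberField K]
  {hcpt : isCompact_glFiniteIntegralLevel n K}
  {μ : Measure (AdelicGroupData.gl n K).automorphicQuotient}
  [(AdelicGroupData.gl n K).IsAutomorphicMeasure μ]

/-- `K_∞` acts on the `U`-fixed vectors `(W / W')^U` through its action on `W / W'`:
`↑(π.kRepFixed U k v) = π.kRep k ↑v` (definitional unfolding of `Representation.subrepresentation`).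
Borel–Jacquet 1979, 4.5–4.6. [folklore] -/
theorem AutomorphicRepData.coe_kRepFixed_apply (π : AutomorphicRepData (AutomorphyDatum.gl n K hcpt))
    (U : Subgroup (AutomorphyDatum.gl n K hcpt).finiteAdelic)
    (k : (AutomorphyDatum.gl n K hcpt).arch.maximalCompact) (v : π.finiteRep.fixedPoints U) :
    ((π.kRepFixed U k v : π.finiteRep.fixedPoints U) : π.Quot) = π.kRep k (v : π.Quot) :=
  rfl

/-- **Continuous representatives depend linearly on the class, are unique, and follow
translations.** For a space `W` of continuous functions on `GL_n(𝔸_K)` there is a linear map `Φ`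
from the classes `[W] = l2OfForms W` to functions on the quotient such that `Φ x` is the unique
continuous square-integrable representative of `x` (`μ` charges open sets, so continuous functions
equal a.e. are equal), `invQuot (Φ x) ∈ W`, and the representative of a translate `R(y) x ∈ [W]` is
the translate `q ↦ Φ x (y⁻¹ q)` of the representative. [folklore] -/
theorem exists_linearMap_continuous_toLp_eq_of_l2OfForms
    {W : Submodule ℂ ((AdelicGroupData.gl n K).Adelic → ℂ)} (hWc : ∀ ψ ∈ W, Continuous ψ) :
    ∃ Φ : l2OfForms (AdelicGroupData.gl n K) μ W →ₗ[ℂ]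
        ((AdelicGroupData.gl n K).automorphicQuotient → ℂ),
      (∀ x, Continuous (Φ x)) ∧ (∀ x, invQuot (AdelicGroupData.gl n K) (Φ x) ∈ W) ∧
        (∀ x : l2OfForms (AdelicGroupData.gl n K) μ W, ∃ hF : MemLp (Φ x) 2 μ,
          hF.toLp (Φ x) = (x : (AdelicGroupData.gl n K).L2 μ)) ∧
          (∀ x : l2OfForms (AdelicGroupData.gl n K) μ W,
            ∀ F : (AdelicGroupData.gl n K).automorphicQuotient → ℂ, Continuous F →
              ∀ hF : MemLp F 2 μ, hF.toLp F = (x : (AdelicGroupData.gl n K).L2 μ) → F = Φ x) ∧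
            ∀ (x x' : l2OfForms (AdelicGroupData.gl n K) μ W) (y : (AdelicGroupData.gl n K).Adelic),
              (x' : (AdelicGroupData.gl n K).L2 μ) = (AdelicGroupData.gl n K).rightRegular μ y x →
                Φ x' = fun q ↦ Φ x (y⁻¹ • q) := by
  have hrep : ∀ x : l2OfForms (AdelicGroupData.gl n K) μ W,
      ∃ (g : (AdelicGroupData.gl n K).automorphicQuotient → ℂ) (hg : MemLp g 2 μ),
        hg.toLp g = x ∧ invQuot (AdelicGroupData.gl n K) g ∈ W := fun x ↦ x.2
  choose g hg hgx hgW using hrep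
  have hcont : ∀ x, Continuous (g x) := fun x ↦ continuous_of_continuous_invQuot (hWc _ (hgW x))
  have huniq : ∀ (x : l2OfForms (AdelicGroupData.gl n K) μ W)
      (F : (AdelicGroupData.gl n K).automorphicQuotient → ℂ), Continuous F → ∀ hF : MemLp F 2 μ,
      hF.toLp F = (x : (AdelicGroupData.gl n K).L2 μ) → F = g x := fun x F hc hF h ↦
    Measure.eq_of_ae_eq ((MemLp.toLp_eq_toLp_iff hF (hg x)).mp (h.trans (hgx x).symm)) hc (hcont x)
  refine ⟨{ toFun := g, map_add' := fun x y ↦ ?_, map_smul' := fun c x ↦ ?_ },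
    hcont, hgW, fun x ↦ ⟨hg x, hgx x⟩, fun x F hc hF h ↦ huniq x F hc hF h, fun x x' y h ↦ ?_⟩
  · symm
    refine huniq (x + y) (g x + g y) ((hcont x).add (hcont y)) ((hg x).add (hg y)) ?_
    rw [MemLp.toLp_add (hg x) (hg y), hgx, hgx, Submodule.coe_add]
  · symm
    refine huniq (c • x) (c • g x) ((hcont x).const_smul c) ((hg x).const_smul c) ?_
    rw [MemLp.toLp_const_smul c (hg x), hgx, Submodule.coe_smul]
  · symm
    refine huniq x' _ ((hcont x).comp (continuous_const_smul y⁻¹))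
      ((hg x).comp_measurePreserving (measurePreserving_smul y⁻¹ μ)) ?_
    rw [h, ← hgx x, AdelicGroupData.rightRegular_apply, DomMulAct.mk_smul_toLp]
    rfl

/-- **The form attached to a class.** For a space `W` of continuous functions on `GL_n(𝔸_K)` and
a subspace `S` of the classes `[W]`, the map `[g] ↦ invQuot g` (continuous representative) is an
injective linear map `ψ : S → W`, and it takes translates to translates: if `x' = R(y) x` then
`ψ x' = r(y) (ψ x)` (`invQuot_smul`). Borel–Jacquet 1979, 4.6 (the dictionary between `L²` and
right translation of automorphic forms). [cite: BorelJacquetCorvallis1979, 4.6] -/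
theorem exists_linearMap_form_of_l2OfForms
    {W : Submodule ℂ ((AdelicGroupData.gl n K).Adelic → ℂ)} (hWc : ∀ ψ ∈ W, Continuous ψ)
    (S : Submodule ℂ ((AdelicGroupData.gl n K).L2 μ))
    (hS : S ≤ l2OfForms (AdelicGroupData.gl n K) μ W) :
    ∃ ψ : S →ₗ[ℂ] W, Function.Injective ψ ∧
      ∀ (x x' : S) (y : (AdelicGroupData.gl n K).Adelic),
        (x' : (AdelicGroupData.gl n K).L2 μ) = (AdelicGroupData.gl n K).rightRegular μ y x →
          (ψ x' : (AdelicGroupData.gl n K).Adelic → ℂ) =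
            rightTranslation (AdelicGroupData.gl n K) y (ψ x) := by
  obtain ⟨Φ, -, hΦW, hΦx, -, hΦR⟩ := exists_linearMap_continuous_toLp_eq_of_l2OfForms (μ := μ) hWc
  let ι : S →ₗ[ℂ] l2OfForms (AdelicGroupData.gl n K) μ W := Submodule.inclusion hS
  let ψ : S →ₗ[ℂ] W :=
    { toFun := fun x ↦ ⟨invQuot (AdelicGroupData.gl n K) (Φ (ι x)), hΦW (ι x)⟩
      map_add' := fun x y ↦ by
        apply Subtype.ext
        change invQuot (AdelicGroupData.gl n K) (Φ (ι (x + y))) =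
          invQuot (AdelicGroupData.gl n K) (Φ (ι x)) + invQuot (AdelicGroupData.gl n K) (Φ (ι y))
        rw [map_add, map_add]
        rfl
      map_smul' := fun c x ↦ by
        apply Subtype.ext
        change invQuot (AdelicGroupData.gl n K) (Φ (ι (c • x))) =
          c • invQuot (AdelicGroupData.gl n K) (Φ (ι x))
        rw [map_smul, map_smul]
        rfl }
  have hψ : ∀ x, (ψ x : (AdelicGroupData.gl n K).Adelic → ℂ) =
      invQuot (AdelicGroupData.gl n K) (Φ (ι x)) := fun x ↦ rfl
  refine ⟨ψ, fun x y hxy ↦ ?_, fun x x' y h ↦ ?_⟩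
  · have h2 : (ψ x : (AdelicGroupData.gl n K).Adelic → ℂ) = ψ y := congrArg Subtype.val hxy
    rw [hψ, hψ] at h2
    have h3 : Φ (ι x) = Φ (ι y) := invQuot_injective _ h2
    apply Subtype.ext
    obtain ⟨hFx, hx⟩ := hΦx (ι x)
    obtain ⟨hFy, hy⟩ := hΦx (ι y)
    change ((ι x : l2OfForms (AdelicGroupData.gl n K) μ W) : (AdelicGroupData.gl n K).L2 μ) =
      ((ι y : l2OfForms (AdelicGroupData.gl n K) μ W) : (AdelicGroupData.gl n K).L2 μ)
    rw [← hx, ← hy]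
    exact (MemLp.toLp_eq_toLp_iff hFx hFy).mpr (Filter.Eventually.of_forall fun q ↦ congrFun h3 q)
  · rw [hψ, hψ, hΦR (ι x) (ι x') y h]
    exact invQuot_smul (AdelicGroupData.gl n K) (Φ (ι x)) y

/-- **The `U`-fixed classes of `W` embed `K_∞`-equivariantly into `(W / ⊥)^U`.** Let `π = W / W'`
be an automorphic representation datum of `GL_n` with `W' = ⊥`, `U ≤ GL_n(𝔸_K)` a subgroup,
`Fix` a subspace of `L²` of `R(U)`-fixed vectors, and `S = [W] ∩ Fix` — assumed `K_∞`-stable — the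
classes of elements of `W` in it. Then `[g] ↦ (invQuot g) mod ⊥` is an injective `K_∞`-map from `S`
(with the action `kinfRegular = R ∘ ofK`) to the `K_∞`-module `(W / ⊥)^U = π.kRepFixed U` of
Borel–Jacquet 4.5: the form attached to a class follows translations
(`exists_linearMap_form_of_l2OfForms`) — so the form of an `R(U)`-fixed class is `U`-invariant and
`R(ofK k)` goes to `r(ofK k)` — and `W → W / ⊥` is injective.
Borel–Jacquet 1979, 4.5–4.6. [cite: BorelJacquetCorvallis1979, 4.5–4.6] -/
theorem exists_injective_intertwiningMap_kRepFixed
    (π : AutomorphicRepData (AutomorphyDatum.gl n K hcpt)) (hbot : π.W' = ⊥)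
    (U : Subgroup (AdelicGroupData.gl n K).Adelic)
    {Fix : Submodule ℂ ((AdelicGroupData.gl n K).L2 μ)}
    (hFix : ∀ x ∈ Fix, ∀ u ∈ U, (AdelicGroupData.gl n K).rightRegular μ u x = x)
    (hSK : ∀ k, ∀ v ∈ l2OfForms (AdelicGroupData.gl n K) μ π.W ⊓ Fix,
      kinfRegular hcpt μ k v ∈ l2OfForms (AdelicGroupData.gl n K) μ π.W ⊓ Fix) :
    ∃ T : ((kinfRegular hcpt μ).subRep _ hSK).IntertwiningMap
        (π.kRepFixed (U.subgroupOf (AutomorphyDatum.gl n K hcpt).finiteAdelic)),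
      Function.Injective T := by
  have hWc : ∀ ψ ∈ π.W, Continuous ψ := fun ψ hψ ↦
    continuous_of_mem_automorphicForms_gl (π.stable.le_automorphicForms hψ)
  obtain ⟨ψ, hψinj, hψR⟩ := exists_linearMap_form_of_l2OfForms (μ := μ) hWc
    (l2OfForms (AdelicGroupData.gl n K) μ π.W ⊓ Fix) inf_le_left
  -- `ψ x` is right invariant under `U`
  have hψU : ∀ x, ∀ u ∈ U, rightTranslation (AdelicGroupData.gl n K) u
      (ψ x : (AdelicGroupData.gl n K).Adelic → ℂ) = ψ x :=
    fun x u hu ↦ (hψR x x u (hFix _ x.2.2 u hu).symm).symm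
  -- the quotient map `W → W / ⊥` is injective
  have hmkQ : Function.Injective π.mkQ := by
    rw [← LinearMap.ker_eq_bot]
    change LinearMap.ker π.kerQuot.mkQ = ⊥
    rw [Submodule.ker_mkQ]
    change π.W'.comap π.W.subtype = ⊥
    rw [hbot, Submodule.comap_bot, Submodule.ker_subtype]
  -- the values are `U`-fixed in `W / ⊥`
  have hψfix : ∀ x, π.mkQ (ψ x) ∈
      π.finiteRep.fixedPoints (U.subgroupOf (AutomorphyDatum.gl n K hcpt).finiteAdelic) := by
    intro x
    rw [Representation.mem_fixedPoints]
    intro h hh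
    change π.finiteRep h (Submodule.Quotient.mk (ψ x)) = Submodule.Quotient.mk (ψ x)
    rw [AutomorphicRepData.finiteRep_mk]
    congr 1
    apply Subtype.ext
    exact hψU x _ (Subgroup.mem_subgroupOf.mp hh)
  -- the `K_∞`-map
  let T₀ : ↥(l2OfForms (AdelicGroupData.gl n K) μ π.W ⊓ Fix) →ₗ[ℂ]
      π.finiteRep.fixedPoints (U.subgroupOf (AutomorphyDatum.gl n K hcpt).finiteAdelic) :=
    LinearMap.codRestrict _ (π.mkQ ∘ₗ ψ) hψfix
  have hT₀ : ∀ x, (T₀ x : π.Quot) = Submodule.Quotient.mk (ψ x) := fun x ↦ rfl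
  refine ⟨T₀.intertwiningMap_of_isIntertwiningMap _ _ fun k x ↦ ?_, ?_⟩
  · apply Subtype.ext
    rw [AutomorphicRepData.coe_kRepFixed_apply, hT₀, hT₀, AutomorphicRepData.kRep_mk]
    congr 1
    exact Subtype.ext (hψR x _ _ rfl)
  · intro x y hxy
    have h1 : (T₀ x : π.Quot) = T₀ y := congrArg Subtype.val hxy
    rw [hT₀, hT₀] at h1
    exact hψinj (hmkQ h1)

end Representatives

/-! ### 3. `K_∞`-finite `U`-fixed vectors of `Cl[W]` lie in `[W]` when `[W] ∩ Fix(U)` is admissible -/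

section Machine

variable {n : ℕ} {K : Type} [Field K] [NumberField K]
  {hcpt : isCompact_glFiniteIntegralLevel n K}
  {μ : Measure (AdelicGroupData.gl n K).automorphicQuotient}
  [(AdelicGroupData.gl n K).IsAutomorphicMeasure μ]

/-- **Harish-Chandra's `Cl(V') ∩ U' = V'` by orthogonal projections** (the argument of Step 3b of
`AutomorphicRepsGLCuspidalL2Step3b`, with the admissibility of the ambient cuspidal `Π^U` replaced
by that of `S = [W] ∩ Fix(U)` itself). Let `W` be a `(𝔤, K_∞) × GL_n(𝔸_K^∞)`-stable space of
automorphic forms on `GL_n(𝔸_K)`, `U = {1} × U₀` with `U₀ ≤ GL_n(𝔸_K^∞)` compact, `[W] = l2OfForms W`,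
`Fix(U)` the `R(U)`-fixed vectors of `L²`, and assume the `K_∞`-module `S = [W] ∩ Fix(U)` has
finite `K_∞`-multiplicities. Then every `K_∞`-finite `x ∈ Cl[W] ∩ Fix(U)` lies in `[W]`: with `F`
the orbit span of `x`, `p` the orthogonal projection onto `Fix(U)` and `q` the one onto the closure
`M` of the `F`-part of `L²`, `E = q ∘ p` fixes `x`; `p` maps `[W]` into `S` (the `U`-orbit of a
class of `W` is finite, `finite_range_rightRegular_ofFinite`, so `p` of it stays in the span,
`starProjection_invariants_mem`), `q` maps `S` into `S ∩ M`
(`starProjection_closure_homRangeSum_mem_tauPart`; `q` commutes with `R(U)`), and `S ∩ M` lies in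
the `F`-part `A` of `S` (`mem_tauPart_of_le_closure`), finite-dimensional by the assumption
(`finiteDimensional_intertwiningMap_of_irreducible`, `finiteDimensional_tauPart`); so `E [W]` lies
in the closed `[W] ∩ A` and `x = E x ∈ Cl(E [W]) ⊆ [W]`. Harish-Chandra 1953, Thm. 5 (proof,
p. 229); Libine 2012, Lemma 74. [cite: HarishChandraTAMS1953, Thm. 5 (pp. 228–229)] -/
theorem mem_l2OfForms_of_mem_closure_of_kFinite
    {W : Submodule ℂ ((AdelicGroupData.gl n K).Adelic → ℂ)}
    (hW : IsStableSubmodule (AutomorphyDatum.gl n K hcpt) W)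
    {U₀ : Subgroup (GL (Fin n) (FiniteAdeleRing (𝓞 K) K))}
    (hU₀c : IsCompact (U₀ : Set (GL (Fin n) (FiniteAdeleRing (𝓞 K) K))))
    (hSK : ∀ k, ∀ v ∈ l2OfForms (AdelicGroupData.gl n K) μ W ⊓
        (((AdelicGroupData.gl n K).rightRegular μ).restrict (U₀.map (GLn.ofFinite n K)).subtype).invariants,
      kinfRegular hcpt μ k v ∈ l2OfForms (AdelicGroupData.gl n K) μ W ⊓
        (((AdelicGroupData.gl n K).rightRegular μ).restrict (U₀.map (GLn.ofFinite n K)).subtype).invariants)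
    (hadmS : IsAdmissibleGK ((kinfRegular hcpt μ).subRep _ hSK))
    {x : (AdelicGroupData.gl n K).L2 μ}
    (hxcl : x ∈ (l2OfForms (AdelicGroupData.gl n K) μ W).topologicalClosure)
    (hxFix : x ∈ (((AdelicGroupData.gl n K).rightRegular μ).restrict
      (U₀.map (GLn.ofFinite n K)).subtype).invariants)
    (hxK : FiniteDimensional ℂ ((kinfRegular hcpt μ).orbitSpan x)) :
    x ∈ l2OfForms (AdelicGroupData.gl n K) μ W := by
  -- Step 0: notation, continuity and `K_∞`-finiteness of the elements of `W`
  set L : Submodule ℂ ((AdelicGroupData.gl n K).L2 μ) :=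
    l2OfForms (AdelicGroupData.gl n K) μ W with hL_def
  set U : Subgroup (AdelicGroupData.gl n K).Adelic := U₀.map (GLn.ofFinite n K) with hU_def
  have hUfin : U ≤ (AutomorphyDatum.gl n K hcpt).finiteAdelic := Subgroup.map_le_range _ _
  have hWc : ∀ ψ ∈ W, Continuous ψ := fun ψ hψ ↦
    continuous_of_mem_automorphicForms_gl (hW.le_automorphicForms hψ)
  have hWk : ∀ ψ ∈ W, IsKFinite (AutomorphyDatum.gl n K hcpt).ofArch ψ := fun ψ hψ ↦
    hW.isKFinite hψ
  set σ := kinfRegular hcpt μ with hσ_def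
  have hσ : σ.IsUnitary := isUnitary_kinfRegular
  have hLK : ∀ k, ∀ v ∈ L, σ k v ∈ L := fun k v hv ↦
    rightRegular_apply_mem_l2OfForms (hW.k_stable k) hv
  set πU : ContRepresentation ℂ U ((AdelicGroupData.gl n K).L2 μ) :=
    ((AdelicGroupData.gl n K).rightRegular μ).restrict U.subtype with hπU_def
  have hπU : πU.IsUnitary := fun u ↦ (AdelicGroupData.gl n K).isUnitary_rightRegular μ _
  set Fix : Submodule ℂ ((AdelicGroupData.gl n K).L2 μ) := πU.invariants with hFix_def
  haveI hFixc : CompleteSpace Fix := by rw [hFix_def]; infer_instance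
  -- restate the hypotheses in the abbreviated form (syntactic match for instances and rewriting)
  have hxFix' : x ∈ Fix := hxFix
  have hSK' : ∀ k, ∀ v ∈ L ⊓ Fix, σ k v ∈ L ⊓ Fix := hSK
  have hadmS' : IsAdmissibleGK (σ.subRep (L ⊓ Fix) hSK') := hadmS
  -- Step 1: the orbit span `F` of `x`, the closure `M` of the `F`-part, `E = q ∘ p` fixing `x`
  set F : Submodule ℂ ((AdelicGroupData.gl n K).L2 μ) := σ.orbitSpan x with hF_def
  haveI hFfin : FiniteDimensional ℂ F := hxK
  have hFK : ∀ k, ∀ v ∈ F, σ k v ∈ F := fun k v hv ↦ σ.apply_mem_orbitSpan_of_mem k hv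
  have hxF : x ∈ F := σ.mem_orbitSpan_self x
  set M : Submodule ℂ ((AdelicGroupData.gl n K).L2 μ) :=
    (Representation.homRangeSum σ.toRepresentation (σ.subRep F hFK)).topologicalClosure with hM_def
  haveI hMc : CompleteSpace M := by rw [hM_def]; infer_instance
  have hxM : x ∈ M := Submodule.le_topologicalClosure _
    (Representation.apply_mem_homRangeSum (σ.subRepSubtype F hFK) ⟨x, hxF⟩)
  set E : (AdelicGroupData.gl n K).L2 μ →L[ℂ] (AdelicGroupData.gl n K).L2 μ :=
    M.starProjection ∘L Fix.starProjection with hE_def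
  have hEx : E x = x := by
    rw [hE_def, ContinuousLinearMap.comp_apply, Submodule.starProjection_eq_self_iff.mpr hxFix',
      Submodule.starProjection_eq_self_iff.mpr hxM]
  -- Step 2: the `F`-part `A` of `S = L ⊓ Fix`, finite-dimensional by admissibility of `S`
  set A' : Submodule ℂ ((AdelicGroupData.gl n K).L2 μ) :=
    σ.tauPart (σ.subRep F hFK) (L ⊓ Fix) hSK' with hA_def
  haveI : FiniteDimensional ℂ ((σ.subRep F hFK).IntertwiningMap (σ.subRep (L ⊓ Fix) hSK')) :=
    hσ.finiteDimensional_intertwiningMap_of_irreducible (σ.subRep (L ⊓ Fix) hSK')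
      (fun E' hE' hfin hirr ↦ by
        haveI := hfin
        exact hadmS' _ (σ.subRep E' hE') hirr) F hFK
  haveI hAfin : FiniteDimensional ℂ A' := ContRepresentation.finiteDimensional_tauPart hSK'
  -- Step 3: stability properties
  have hMK : ∀ k, ∀ v ∈ M, σ k v ∈ M := fun k v hv ↦
    ContRepresentation.apply_mem_closure_homRangeSum k hv
  have hMU : ∀ u : U, ∀ v ∈ M, πU u v ∈ M := by
    intro u v hv
    have hcomm : ∀ k, πU u ∘L σ k = σ k ∘L πU u := fun k ↦
      ContinuousLinearMap.ext fun w ↦ (rightRegular_ofK_comm k (hUfin u.2) w).symm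
    exact ContRepresentation.map_closure_homRangeSum_le_of_commute (σ := σ) (πU u) hcomm ⟨v, hv, rfl⟩
  -- 3a: `p` maps `L` into `L ⊓ Fix` (the `U`-orbit of `w ∈ L` is finite)
  have hp : ∀ w ∈ L, Fix.starProjection w ∈ L ⊓ Fix := by
    intro w hw
    refine ⟨?_, Fix.starProjection_apply_mem w⟩
    obtain ⟨g, hg, rfl, hgW⟩ := hw
    obtain ⟨U₂, hU₂o, hU₂fix⟩ :=
      exists_isOpen_forall_rightTranslation_ofFinite_eq (hW.le_automorphicForms hgW)
    have hfix₂ : ∀ u ∈ U₂, (AdelicGroupData.gl n K).rightRegular μ (GLn.ofFinite n K u)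
        (hg.toLp g) = hg.toLp g := fun u hu ↦ rightRegular_toLp_eq_self hg (hU₂fix u hu)
    have hfinite : (Set.range fun u : U ↦ πU u (hg.toLp g)).Finite := by
      refine (finite_range_rightRegular_ofFinite (μ := μ) hU₀c hU₂o hfix₂).subset ?_
      rintro _ ⟨u, rfl⟩
      obtain ⟨u₀, hu₀, hu⟩ := Subgroup.mem_map.mp u.2
      refine ⟨⟨u₀, hu₀⟩, ?_⟩
      exact congrArg (fun a ↦ (AdelicGroupData.gl n K).rightRegular μ a (hg.toLp g)) hu
    haveI : FiniteDimensional ℂ (πU.orbitSpan (hg.toLp g)) :=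
      πU.finiteDimensional_orbitSpan_of_finite hfinite
    have hVst : ∀ u, ∀ v ∈ πU.orbitSpan (hg.toLp g), πU u v ∈ πU.orbitSpan (hg.toLp g) :=
      fun u v hv ↦ πU.apply_mem_orbitSpan_of_mem u hv
    have hmem := hπU.starProjection_invariants_mem (Submodule.closed_of_finiteDimensional _) hVst
      (πU.mem_orbitSpan_self (hg.toLp g))
    refine πU.orbitSpan_le (S := L) (fun u v hv ↦ ?_) (toLp_mem_l2OfForms hg hgW) hmem
    exact rightRegular_apply_mem_l2OfForms (hW.finite_stable _ (hUfin u.2)) hv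
  -- 3b: `q` maps `L ⊓ Fix` into `(L ⊓ Fix) ⊓ M`
  have hq : ∀ v ∈ L ⊓ Fix, M.starProjection v ∈ (L ⊓ Fix) ⊓ M := by
    rintro v ⟨hvL, hvFix⟩
    haveI : FiniteDimensional ℂ (σ.orbitSpan v) :=
      finiteDimensional_orbitSpan_of_mem_l2OfForms hWc hWk hvL
    have hvK : ∀ k, ∀ y ∈ σ.orbitSpan v, σ k y ∈ σ.orbitSpan v := fun k y hy ↦
      σ.apply_mem_orbitSpan_of_mem k hy
    refine ⟨⟨?_, ?_⟩, M.starProjection_apply_mem v⟩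
    · have h := hσ.starProjection_closure_homRangeSum_mem_tauPart (τ := σ.subRep F hFK) hvK
        (σ.mem_orbitSpan_self v)
      exact σ.orbitSpan_le hLK hvL (ContRepresentation.tauPart_le hvK h)
    · change M.starProjection v ∈ πU.invariants
      refine (ContRepresentation.mem_invariants (M.starProjection v)).mpr fun u ↦ ?_
      have h1 := hπU.starProjection_map_eq (M := M) hMU u v
      have h2 : πU u v = v := (ContRepresentation.mem_invariants v).mp hvFix u
      rw [h2] at h1
      exact h1.symm
  -- 3c: `(L ⊓ Fix) ⊓ M ≤ A`: `K_∞`-finite vectors in the closure of the `F`-part are algebraic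
  have hA : ∀ v ∈ (L ⊓ Fix) ⊓ M, v ∈ A' := by
    rintro v ⟨⟨hvL, hvFix⟩, hvM⟩
    haveI : FiniteDimensional ℂ (σ.orbitSpan v) :=
      finiteDimensional_orbitSpan_of_mem_l2OfForms hWc hWk hvL
    have hvK : ∀ k, ∀ y ∈ σ.orbitSpan v, σ k y ∈ σ.orbitSpan v := fun k y hy ↦
      σ.apply_mem_orbitSpan_of_mem k hy
    have hle : σ.orbitSpan v ≤ M := σ.orbitSpan_le hMK hvM
    have h := hσ.mem_tauPart_of_le_closure (τ := σ.subRep F hFK) hvK hle (σ.mem_orbitSpan_self v)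
    refine ContRepresentation.tauPart_mono hvK hSK' ?_ h
    exact σ.orbitSpan_le hSK' ⟨hvL, hvFix⟩
  -- Step 4: `E` maps `L` into the finite-dimensional (closed) `L ⊓ A`, and `E x = x ∈ Cl(L)`
  have hEL : Set.MapsTo E (L : Set ((AdelicGroupData.gl n K).L2 μ))
      ((L ⊓ A' : Submodule ℂ ((AdelicGroupData.gl n K).L2 μ)) : Set ((AdelicGroupData.gl n K).L2 μ)) := by
    intro w hw
    have h2 := hq _ (hp w hw)
    exact ⟨h2.1.1, hA _ h2⟩
  haveI : FiniteDimensional ℂ ↥(L ⊓ A') := Submodule.finiteDimensional_of_le inf_le_right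
  have hclosed : IsClosed ((L ⊓ A' : Submodule ℂ ((AdelicGroupData.gl n K).L2 μ)) :
      Set ((AdelicGroupData.gl n K).L2 μ)) :=
    Submodule.closed_of_finiteDimensional _
  have hxcl' : x ∈ closure (L : Set ((AdelicGroupData.gl n K).L2 μ)) := by
    rw [← Submodule.topologicalClosure_coe]
    exact hxcl
  have h := (hEL.closure E.continuous) hxcl'
  rw [hclosed.closure_eq, hEx] at h
  exact h.1

end Machine

/-! ### 4. The `K`-finite half of Harish-Chandra's correspondence from admissibility (proved) -/

section Main

variable {n : ℕ} {K : Type} [Field K] [NumberField K]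
  {hcpt : isCompact_glFiniteIntegralLevel n K}
  {μ : Measure (AdelicGroupData.gl n K).automorphicQuotient}
  [(AdelicGroupData.gl n K).IsAutomorphicMeasure μ]

/-- **Non-zero closed invariant subspaces of `Cl[W]` meet `[W]`, for `W` with admissible
`U`-fixed vectors** (the `K`-finite half of Harish-Chandra's Thm. 5, proved from admissibility).
Assume that for every cuspidal datum `π = W / ⊥` of `GL_n(𝔸_K)` and every level `U` the
`K_∞`-module `(W / ⊥)^U` has finite `K_∞`-multiplicities (`IsAdmissibleGK (π.kRepFixed _)`; this is
the second clause of the named fact `automorphicRep_isAdmissible hcpt` of `LangAutomorphicForms`,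
Borel–Jacquet 1979, 4.5, restricted to these data). Then
`cuspidal_closure_exists_mem_l2OfForms hcpt μ` holds: for `⊥ ≠ Q ≤ Cl[W]` closed and
`GL_n(𝔸_K)`-invariant, some `w = [g] ∈ [W]` has `x = P_Q w ≠ 0` (`P_Q` the orthogonal projection
onto `Q`, which commutes with `R`, `IsUnitary.starProjection_map_eq`; otherwise
`Q ⊆ Cl[W] ⊆ Qᗮ`), and `x ∈ Q ⊆ Cl[W]` is fixed by the level `U = {1} × U₀` of `invQuot g` and
`K_∞`-finite (its orbit span is `P_Q` of that of `w`), while `[W] ∩ Fix(U)` embeds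
`K_∞`-equivariantly into the admissible `(W / ⊥)^U` (`exists_injective_intertwiningMap_kRepFixed`,
`isAdmissibleGK_of_injective`); so `x ∈ [W]` by `mem_l2OfForms_of_mem_closure_of_kFinite`.
Harish-Chandra 1953, Thm. 5 (proof, p. 229); Libine 2012, Lemma 74. [cite: HarishChandraTAMS1953, Thm. 5 (pp. 228–229)] -/
theorem AutomorphicRepsGL.cuspidal_closure_exists_mem_l2OfForms_of_isAdmissibleGK
    (hadm : ∀ π : CuspidalAutomorphicRepData n K hcpt, π.1.W' = ⊥ →
      ∀ U ∈ finiteLevelsGL n K,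
        IsAdmissibleGK (π.1.kRepFixed (U.subgroupOf (AutomorphyDatum.gl n K hcpt).finiteAdelic))) :
    AutomorphicRepsGL.cuspidal_closure_exists_mem_l2OfForms hcpt μ := by
  intro π hbot _ Q hQ hQ0
  -- Step 0: notation
  have hW := π.1.stable
  have hWc : ∀ ψ ∈ π.1.W, Continuous ψ := fun ψ hψ ↦
    continuous_of_mem_automorphicForms_gl (hW.le_automorphicForms hψ)
  have hWk : ∀ ψ ∈ π.1.W, IsKFinite (AutomorphyDatum.gl n K hcpt).ofArch ψ := fun ψ hψ ↦
    hW.isKFinite hψ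
  have hR : ((AdelicGroupData.gl n K).rightRegular μ).IsUnitary :=
    (AdelicGroupData.gl n K).isUnitary_rightRegular μ
  -- Step 1: the orthogonal projection onto `Q` commutes with `R`, and does not kill `[W]`
  have hQK : ∀ g, ∀ v ∈ Q.toSubmodule, (AdelicGroupData.gl n K).rightRegular μ g v ∈ Q.toSubmodule :=
    fun g v hv ↦ Q.apply_mem g hv
  have hPR : ∀ g v, Q.toSubmodule.starProjection ((AdelicGroupData.gl n K).rightRegular μ g v) =
      (AdelicGroupData.gl n K).rightRegular μ g (Q.toSubmodule.starProjection v) := fun g v ↦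
    hR.starProjection_map_eq hQK g v
  have hex : ∃ w ∈ l2OfForms (AdelicGroupData.gl n K) μ π.1.W, Q.toSubmodule.starProjection w ≠ 0 := by
    by_contra hcon
    push Not at hcon
    have hLQ : l2OfForms (AdelicGroupData.gl n K) μ π.1.W ≤ Q.toSubmoduleᗮ := fun w hw ↦
      (Submodule.starProjection_apply_eq_zero_iff Q.toSubmodule).mp (hcon w hw)
    have hClQ : (l2OfForms (AdelicGroupData.gl n K) μ π.1.W).topologicalClosure ≤ Q.toSubmoduleᗮ :=
      Submodule.topologicalClosure_minimal _ hLQ (Submodule.isClosed_orthogonal _)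
    apply hQ0
    refine ContRepresentation.ClosedSubrep.ext fun v ↦ ?_
    rw [ContRepresentation.ClosedSubrep.mem_bot]
    constructor
    · intro hv
      have hv' : v ∈ Q.toSubmodule ⊓ Q.toSubmoduleᗮ := ⟨hv, hClQ (hQ hv)⟩
      rwa [Submodule.inf_orthogonal_eq_bot, Submodule.mem_bot] at hv'
    · rintro rfl
      exact Q.toSubmodule.zero_mem
  obtain ⟨w, hwL, hw0⟩ := hex
  obtain ⟨g, hg, rfl, hgW⟩ := hwL
  have hwL : hg.toLp g ∈ l2OfForms (AdelicGroupData.gl n K) μ π.1.W := toLp_mem_l2OfForms hg hgW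
  set x : (AdelicGroupData.gl n K).L2 μ := Q.toSubmodule.starProjection (hg.toLp g) with hx_def
  have hxQ : x ∈ Q.toSubmodule := Q.toSubmodule.starProjection_apply_mem _
  have hxcl : x ∈ (l2OfForms (AdelicGroupData.gl n K) μ π.1.W).topologicalClosure := hQ hxQ
  -- Step 2: a compact open level `U = {1} × U₀` fixing `invQuot g`; `w` and `x` are `U`-fixed
  obtain ⟨U₁, hU₁o, hU₁fix⟩ :=
    exists_isOpen_forall_rightTranslation_ofFinite_eq (hW.le_automorphicForms hgW)
  set U₀ : Subgroup (GL (Fin n) (FiniteAdeleRing (𝓞 K) K)) := U₁ ⊓ glFiniteIntegralLevel n K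
    with hU₀_def
  have hU₀o : IsOpen (U₀ : Set (GL (Fin n) (FiniteAdeleRing (𝓞 K) K))) := by
    rw [hU₀_def, Subgroup.coe_inf]
    exact hU₁o.inter (isOpen_glFiniteIntegralLevel n K)
  have hU₀c : IsCompact (U₀ : Set (GL (Fin n) (FiniteAdeleRing (𝓞 K) K))) := by
    rw [hU₀_def, Subgroup.coe_inf]
    exact IsCompact.inter_left hcpt (U₁.isClosed_of_isOpen hU₁o)
  set U : Subgroup (AdelicGroupData.gl n K).Adelic := U₀.map (GLn.ofFinite n K) with hU_def
  have hU : U ∈ finiteLevelsGL n K := ⟨U₀, hU₀o, hU₀c, rfl⟩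
  have hUfin : U ≤ (AutomorphyDatum.gl n K hcpt).finiteAdelic :=
    le_range_ofFinite_of_mem_finiteLevelsGL hU
  have hUφ : ∀ u ∈ U, rightTranslation (AdelicGroupData.gl n K) u
      (invQuot (AdelicGroupData.gl n K) g) = invQuot (AdelicGroupData.gl n K) g := by
    rintro _ ⟨u₀, hu₀, rfl⟩
    exact hU₁fix u₀ hu₀.1
  have hFixU : ∀ v ∈ (((AdelicGroupData.gl n K).rightRegular μ).restrict
      (U).subtype).invariants, ∀ u ∈ U,
        (AdelicGroupData.gl n K).rightRegular μ u v = v := fun v hv u hu ↦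
    (ContRepresentation.mem_invariants v).mp hv ⟨u, hu⟩
  have hwFix : hg.toLp g ∈ (((AdelicGroupData.gl n K).rightRegular μ).restrict
      (U).subtype).invariants :=
    (ContRepresentation.mem_invariants _).mpr fun u ↦ rightRegular_toLp_eq_self hg (hUφ _ u.2)
  have hxFix : x ∈ (((AdelicGroupData.gl n K).rightRegular μ).restrict
      (U).subtype).invariants := by
    refine (ContRepresentation.mem_invariants x).mpr fun u ↦ ?_
    change (AdelicGroupData.gl n K).rightRegular μ (u : (AdelicGroupData.gl n K).Adelic) x = x
    rw [hx_def, ← hPR, hFixU _ hwFix _ u.2]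
  -- Step 3: `x` is `K_∞`-finite: its orbit span is the image under `P_Q` of that of `w`
  haveI hFw : FiniteDimensional ℂ ((kinfRegular hcpt μ).orbitSpan (hg.toLp g)) :=
    finiteDimensional_orbitSpan_of_mem_l2OfForms hWc hWk hwL
  have hFle : (kinfRegular hcpt μ).orbitSpan x ≤ ((kinfRegular hcpt μ).orbitSpan (hg.toLp g)).map
      (Q.toSubmodule.starProjection : (AdelicGroupData.gl n K).L2 μ →ₗ[ℂ] (AdelicGroupData.gl n K).L2 μ) := by
    refine (kinfRegular hcpt μ).orbitSpan_le (fun k v hv ↦ ?_)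
      ⟨hg.toLp g, (kinfRegular hcpt μ).mem_orbitSpan_self _, rfl⟩
    obtain ⟨v', hv', rfl⟩ := hv
    exact ⟨kinfRegular hcpt μ k v', (kinfRegular hcpt μ).apply_mem_orbitSpan_of_mem k hv', hPR _ v'⟩
  have hxK : FiniteDimensional ℂ ((kinfRegular hcpt μ).orbitSpan x) :=
    Submodule.finiteDimensional_of_le hFle
  -- Step 4: `S = [W] ∩ Fix(U)` embeds into the admissible `(W / ⊥)^U`, and the machine applies
  have hSK : ∀ k, ∀ v ∈ l2OfForms (AdelicGroupData.gl n K) μ π.1.W ⊓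
      (((AdelicGroupData.gl n K).rightRegular μ).restrict (U).subtype).invariants,
      kinfRegular hcpt μ k v ∈ l2OfForms (AdelicGroupData.gl n K) μ π.1.W ⊓
        (((AdelicGroupData.gl n K).rightRegular μ).restrict (U).subtype).invariants :=
    fun k v hv ↦ ⟨rightRegular_apply_mem_l2OfForms (hW.k_stable k) hv.1,
      kinfRegular_apply_mem_invariants hUfin k hv.2⟩
  obtain ⟨T, hT⟩ := exists_injective_intertwiningMap_kRepFixed (μ := μ) π.1 hbot _ hFixU hSK
  have hadmS : IsAdmissibleGK ((kinfRegular hcpt μ).subRep _ hSK) :=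
    isAdmissibleGK_of_injective T hT (hadm π hbot _ hU)
  exact ⟨x, mem_l2OfForms_of_mem_closure_of_kFinite hW hU₀c hSK hadmS hxcl hxFix hxK, hw0, hxQ⟩

/-- **Harish-Chandra's correspondence for irreducible spaces of cusp forms on `GL_n` from
boundedness and admissibility**: `cuspidal_bounded hcpt` (Getz–Hahn Thm. 9.8.1) and the
admissibility of the `(W / ⊥)^U` (second clause of `automorphicRep_isAdmissible hcpt`,
Borel–Jacquet 4.5) imply `cuspidal_closure_irreducible hcpt μ`
(`cuspidal_closure_irreducible_of` of `AutomorphicRepsGLIrreducibleL2HC`: the Lie-stability of the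
space of elements of `W` with class in `Q` is where boundedness enters). Harish-Chandra 1953,
Thm. 5; Libine 2012, Cor. 75. [cite: HarishChandraTAMS1953, Thm. 5 (pp. 228–229)] -/
theorem AutomorphicRepsGL.cuspidal_closure_irreducible_of_isAdmissibleGK
    (hb : AutomorphicRepsGL.cuspidal_bounded hcpt)
    (hadm : ∀ π : CuspidalAutomorphicRepData n K hcpt, π.1.W' = ⊥ →
      ∀ U ∈ finiteLevelsGL n K,
        IsAdmissibleGK (π.1.kRepFixed (U.subgroupOf (AutomorphyDatum.gl n K hcpt).finiteAdelic))) :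
    AutomorphicRepsGL.cuspidal_closure_irreducible hcpt μ :=
  AutomorphicRepsGL.cuspidal_closure_irreducible_of hb
    (AutomorphicRepsGL.cuspidal_closure_exists_mem_l2OfForms_of_isAdmissibleGK hadm)

/-- **The realisation fact over boundedness, analyticity of orbits and admissibility.**
`cuspidal_bounded hcpt`, `cuspidal_analyticAt_rightRegular hcpt μ` (Harish-Chandra's Lemma 34 for
classes of cusp forms) and the admissibility of the `(W / ⊥)^U` imply
`exists_le_formsOfL2_of_W'_eq_bot hcpt μ` (`exists_le_formsOfL2_of_W'_eq_bot_of_analytic` of the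
sibling file). Borel–Jacquet 1979, 4.6; Harish-Chandra 1953, Cor. to Thm. 2 and Thm. 5. [cite: BorelJacquetCorvallis1979, 4.6] -/
theorem AutomorphicRepsGL.exists_le_formsOfL2_of_W'_eq_bot_of_isAdmissibleGK
    (h₁ : AutomorphicRepsGL.cuspidal_bounded hcpt)
    (h₂ : AutomorphicRepsGL.cuspidal_analyticAt_rightRegular hcpt μ)
    (hadm : ∀ π : CuspidalAutomorphicRepData n K hcpt, π.1.W' = ⊥ →
      ∀ U ∈ finiteLevelsGL n K,
        IsAdmissibleGK (π.1.kRepFixed (U.subgroupOf (AutomorphyDatum.gl n K hcpt).finiteAdelic))) :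
    AutomorphicRepsGL.exists_le_formsOfL2_of_W'_eq_bot hcpt μ :=
  AutomorphicRepsGL.exists_le_formsOfL2_of_W'_eq_bot_of_analytic h₁ h₂
    (AutomorphicRepsGL.cuspidal_closure_exists_mem_l2OfForms_of_isAdmissibleGK hadm)

/-- **`exists_isAssociatedL2` over the same base** plus semisimplicity (`cuspidal_W'_eq_bot hcpt`)
and the irreducibility of the `V_Π` (`formsOfL2_irreducible hcpt μ`)
(`exists_isAssociatedL2_of_analytic`). Borel–Jacquet 1979, 4.4–4.6. [cite: BorelJacquetCorvallis1979, 4.4–4.6] -/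
theorem AutomorphicRepsGL.exists_isAssociatedL2_of_isAdmissibleGK
    (hss : cuspidal_W'_eq_bot hcpt)
    (h₁ : AutomorphicRepsGL.cuspidal_bounded hcpt)
    (h₂ : AutomorphicRepsGL.cuspidal_analyticAt_rightRegular hcpt μ)
    (hadm : ∀ π : CuspidalAutomorphicRepData n K hcpt, π.1.W' = ⊥ →
      ∀ U ∈ finiteLevelsGL n K,
        IsAdmissibleGK (π.1.kRepFixed (U.subgroupOf (AutomorphyDatum.gl n K hcpt).finiteAdelic)))
    (h₄ : AutomorphicRepsGL.formsOfL2_irreducible hcpt μ) :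
    AutomorphicRepsGL.exists_isAssociatedL2 hcpt μ :=
  AutomorphicRepsGL.exists_isAssociatedL2_of_analytic hss h₁ h₂
    (AutomorphicRepsGL.cuspidal_closure_exists_mem_l2OfForms_of_isAdmissibleGK hadm) h₄

end Main

end Literature.NumberTheory.Automorphic
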